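import Summits.MatrixMultiplication.OmegaCensus.STPP222CubeCyclic
import Literature.Combinatorics.Additive.TightTriangleRemovalProofs
import Mathlib.GroupTheory.Exponent

/-!
# ω-census, STPP law `(2,2,2)³`: every finite abelian group of exponent `≥ 46`

HONEST FRAMING (pub-omega census; verbatim): lottery ticket; floor = certified bounds/negative ranges.
Census STRUCTURE bookkeeping, not progress on `ω` (a `(2,2,2)³` STPP family gives no bound of interest).

`STPP222CubeCyclic.lean` proves that every `ℤ/mℤ` with `m ≥ 46` admits three simultaneous-TPP triples of 2-subsets
(CKSU 2005 Def. 5.1, tree form `IsSTPP`).  This file transports that along the embedding `ℤ/(ord g) ↪ G` generated by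
an element `g`: an additive abelian group with an element of order `≥ 46` admits `(2,2,2)³`, hence so does every
finite abelian group of exponent `≥ 46` (a finite abelian group has an element whose order is the exponent).  This is
the 'cyclic-subgroup' case of the reduction of the census conjecture `STPP222CubeFrom46`; the complementary case
(exponent `≤ 45`, order `≥ 46`) needs the 60 seed groups of `STPP222CubeSeedsA/B.lean` and a subgroup-domination
lemma, which is NOT in this file.

References: H. Cohn, R. Kleinberg, B. Szegedy, C. Umans, FOCS 2005 (arXiv:math/0511460), Def. 5.1.
Record: pub-omega HOME `pub-omega-eng2/results/c4red/C4-REDUCTION-eng2.md` (ENG2 gen 14, 2026-08-23).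
-/

open Literature.Computability.AlgebraicComplexity Finset

namespace Summit.MatrixMultiplication.OmegaCensus

/-- The additive hom `ℤ/nℤ →+ G`, `k ↦ k • g`, for an element `g` of additive order `n` (well defined since
`n • g = 0`). -/
theorem zmultiples_lift_spec {G : Type*} [AddCommGroup G] (g : G) :
    (zmultiplesHom G g) (addOrderOf g : ℕ) = 0 := by
  simp [natCast_zsmul, addOrderOf_nsmul_eq_zero]

/-- The hom `ℤ/(ord g) →+ G`, `k ↦ k • g`, is injective (for `g` of infinite order, `ord g = 0` and `ZMod 0 = ℤ`). -/
theorem zmod_lift_zmultiples_injective {G : Type*} [AddCommGroup G] (g : G) :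
    Function.Injective (ZMod.lift (addOrderOf g) ⟨zmultiplesHom G g, zmultiples_lift_spec g⟩) := by
  rw [ZMod.lift_injective]
  intro m hm
  have hm' : m • g = 0 := by simpa using hm
  exact (ZMod.intCast_zmod_eq_zero_iff_dvd m (addOrderOf g)).2 (addOrderOf_dvd_iff_zsmul_eq_zero.2 hm')

/-- **An abelian group with an element of additive order `≥ 46` admits the STPP pattern `(2,2,2)³`** (transport of
`exists_isSTPP_222cube_zmod` along the injective hom `ℤ/(ord g) ↪ G`, using `IsSTPP.image`).
[cite: CohnKleinbergSzegedyUmans2005, Def. 5.1] -/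
theorem exists_isSTPP_222cube_of_addOrderOf {G : Type*} [AddCommGroup G] (g : G) (hg : 46 ≤ addOrderOf g) :
    ∃ A B C : Fin 3 → Finset G, IsSTPP A B C ∧ ∀ i, (A i).card = 2 ∧ (B i).card = 2 ∧ (C i).card = 2 := by
  classical
  set n := addOrderOf g with hn
  let f : ZMod n →+ G := ZMod.lift n ⟨zmultiplesHom G g, zmultiples_lift_spec g⟩
  have hf : Function.Injective f := zmod_lift_zmultiples_injective g
  obtain ⟨A, B, C, hS, hc⟩ := exists_isSTPP_222cube_zmod n hg
  refine ⟨fun i => (A i).image f, fun i => (B i).image f, fun i => (C i).image f, hS.image f hf, fun i => ?_⟩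
  obtain ⟨hA, hB, hC⟩ := hc i
  exact ⟨by rw [card_image_of_injective _ hf, hA], by rw [card_image_of_injective _ hf, hB],
    by rw [card_image_of_injective _ hf, hC]⟩

/-- **Every finite abelian group of exponent `≥ 46` admits the STPP pattern `(2,2,2)³`** (a finite abelian group
has an element whose additive order equals the exponent).  The cyclic-subgroup case of the census conjecture
`STPP222CubeFrom46`; no `ω` bound follows from it. [cite: CohnKleinbergSzegedyUmans2005, Def. 5.1] -/
theorem exists_isSTPP_222cube_of_exponent {G : Type*} [AddCommGroup G] [Finite G]
    (h : 46 ≤ AddMonoid.exponent G) :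
    ∃ A B C : Fin 3 → Finset G, IsSTPP A B C ∧ ∀ i, (A i).card = 2 ∧ (B i).card = 2 ∧ (C i).card = 2 := by
  obtain ⟨g, hg⟩ := AddMonoid.exists_addOrderOf_eq_exponent (AddMonoid.ExponentExists.of_finite (G := G))
  exact exists_isSTPP_222cube_of_addOrderOf g (by rw [hg]; exact h)

/-- In particular every cyclic group — every finite abelian group whose exponent equals its order — of order `≥ 46`
admits `(2,2,2)³` (e.g. all abelian groups of square-free order `≥ 46`). [cite: CohnKleinbergSzegedyUmans2005, Def. 5.1] -/
theorem exists_isSTPP_222cube_of_isAddCyclic {G : Type*} [AddCommGroup G] [Finite G] [IsAddCyclic G]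
    (h : 46 ≤ Nat.card G) :
    ∃ A B C : Fin 3 → Finset G, IsSTPP A B C ∧ ∀ i, (A i).card = 2 ∧ (B i).card = 2 ∧ (C i).card = 2 :=
  exists_isSTPP_222cube_of_exponent (by rw [IsAddCyclic.exponent_eq_card]; exact h)

end Summit.MatrixMultiplication.OmegaCensus
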